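import Mathlib
import HarnessLib
import HarnessLib.Audit
import Summits.ResolutionOfSingularities.Statement
import Summits.ResolutionOfSingularities.ResolutionOfSingularities.Theses.OrderCut
import Summits.ResolutionOfSingularities.ResolutionOfSingularities.Theses.MaxContactCut
import Literature.AlgebraicGeometry.Resolution.ComponentGluing
import Literature.AlgebraicGeometry.Resolution.Blowups
import Literature.AlgebraicGeometry.Resolution.MarkedIdeals
import Literature.AlgebraicGeometry.Resolution.DiffIdealSheaf

/-!
# MaxContactCut · TauCut kernels (decomp-res cell, lens-2 gen 5; filed by the route-writer decomp-res-writer-1 g3)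

Kernels of the node **TauCut** = the glued split (gen 1) of `MaxContactCut.StepContactFree` (stmt-28004, the
route's declared residual) into `StepCFHigher` (stmt-28537: every contact-free top point has Hironaka τ ≥ 2 —
the Bravo–Villamayor higher-codimensional class [arXiv:0807.4308 Thm 1.1; arXiv:1103.3464 Thm 2.11]) and
`StepPICore` (stmt-28538: some contact-free HYPERPLANAR top point, τ = 1 — Benito–Villamayor's terminal
p-presentations, whose weak ⇒ strong monomial gap over a base of dimension ≥ 3 is their stated open problem
[arXiv:1004.1803 p. 3]), with the dim-4 rungs `StepCFHigherDimFour` (28543) / `StepPICoreDimFour` (28544).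
CRITIC row 33 (2026-08-30T05:25:42Z): CLEARED AS CHILD NODE of MaxContactCut:28004, filing (β).

Contents (0 sorry, pure logic over the route decls):
* `stepContactFreeOfTauCut_holds : MaxContactCut.StepContactFreeOfTauCut` — the split's GLUE item (stmt-28539)
  `StepCFHigher → StepPICore → StepContactFree` (excluded middle on the existence of a purely-inseparable
  hyperplanar top point), and the exactness `stepContactFree_iff_cfHigher_and_core`;
* the three-way partition `step_iff_three : Step ⟺ StepContact ∧ StepCFHigher ∧ StepPICore` and its dim-4 copy;
* the dim-4 LOCATION theorem `pencilResolveDimFour_iff_core_of_pocket`: modulo OrderBound, LocalOrderOneResolveDimFour,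
  StepContactDimFour and StepCFHigherDimFour, `OrderCut.PencilResolveDimFour` (27135) ⟺ `StepPICoreDimFour`;
* necessity of every piece from the ROOT, and `closes_tauCut`: the seven pieces reach the ROOT through
  `MaxContactCut.closes` BY NAME.
Source draft: HOME/decomp-res-lens-2/g5/TauCut.lean (sha256 1f07cdb0…); instrument T-tau-bed-0 (sha256 4a28461b…).
-/

open CategoryTheory AlgebraicGeometry
open Literature.AlgebraicGeometry.Resolution
open Summit.ResolutionOfSingularities.ResolutionOfSingularities.Theses
open Summit.ResolutionOfSingularities.ResolutionOfSingularities.Theses.MaxContactCut (StepCFHigher StepPICore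
  StepCFHigherDimFour StepPICoreDimFour StepContactFreeOfTauCut)

namespace Summit.ResolutionOfSingularities.ResolutionOfSingularities.Theorems.MaxContactCutTauCut

/-! ## Kernels — pure logic: excluded middle on the pointwise datum, no blow-up absorption -/

/-- exactness, generic half: the contact-free step implies its τ ≥ 2 class (forget the hyperplanarity clause). -/
theorem stepCFHigher_of_stepContactFree (h : MaxContactCut.StepContactFree) : StepCFHigher := by
  intro p hp k _ _ n hn ih Y g hg1 hg2 hg3 hY Γ b hb1 hb2 hb3 hbb hΓ hdat
  obtain ⟨I, hbl, hord, ⟨hsome, -⟩, hloc⟩ := hdat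
  exact h p hp k n hn ih Y g hg1 hg2 hg3 hY Γ b hb1 hb2 hb3 hbb hΓ ⟨I, hbl, hord, hsome, hloc⟩

/-- exactness, special half: the contact-free step implies the purely-inseparable hyperplanar core. -/
theorem stepPICore_of_stepContactFree (h : MaxContactCut.StepContactFree) : StepPICore := by
  intro p hp k _ _ n hn ih Y g hg1 hg2 hg3 hY Γ b hb1 hb2 hb3 hbb hΓ hdat
  obtain ⟨I, hbl, hord, ⟨y, hyn, hcf, -⟩, hloc⟩ := hdat
  exact h p hp k n hn ih Y g hg1 hg2 hg3 hY Γ b hb1 hb2 hb3 hbb hΓ ⟨I, hbl, hord, ⟨y, hyn, hcf⟩, hloc⟩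

/-- EXACT refinement of MaxContactCut's residual BY NAME: the contact-free step splits into the higher-type class and the core. -/
theorem stepContactFree_of_cfHigher_of_core (hH : StepCFHigher) (hK : StepPICore) : MaxContactCut.StepContactFree := by
  intro p hp k _ _ n hn ih Y g hg1 hg2 hg3 hY Γ b hb1 hb2 hb3 hbb hΓ hdat
  obtain ⟨I, hbl, hord, hsome, hloc⟩ := hdat
  by_cases hcore : ∃ y : Y, Literature.AlgebraicGeometry.Resolution.idealOrder I y = ((n : ℕ) : ℕ∞) ∧ ¬ (∃ U : Y.affineOpens, ∃ hy : y ∈ (U : Y.Opens), ∃ u ∈ (Literature.AlgebraicGeometry.Resolution.diffIdealSheaf (g.appTop.hom.comp (AlgebraicGeometry.Scheme.ΓSpecIso (.of k)).inv.hom) (n - 1) I).ideal U, (Y.presheaf.germ U y hy).hom u ∈ IsLocalRing.maximalIdeal (Y.presheaf.stalk y) ∧ (Y.presheaf.germ U y hy).hom u ∉ IsLocalRing.maximalIdeal (Y.presheaf.stalk y) ^ 2) ∧ (∃ U : Y.affineOpens, ∃ hy : y ∈ (U : Y.Opens), ∃ z : Y.presheaf.obj (Opposite.op (U : Y.Opens)),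 (Y.presheaf.germ U y hy).hom z ∈ IsLocalRing.maximalIdeal (Y.presheaf.stalk y) ∧ (Y.presheaf.germ U y hy).hom z ∉ IsLocalRing.maximalIdeal (Y.presheaf.stalk y) ^ 2 ∧ ∀ i : ℕ, i < n → ∀ u ∈ (Literature.AlgebraicGeometry.Resolution.diffIdealSheaf (g.appTop.hom.comp (AlgebraicGeometry.Scheme.ΓSpecIso (.of k)).inv.hom) i I).ideal U, (Y.presheaf.germ U y hy).hom u ∈ Ideal.span {(Y.presheaf.germ U y hy).hom z ^ (n - i)} ⊔ IsLocalRing.maximalIdeal (Y.presheaf.stalk y) ^ (n - i + 1))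
  · exact hK p hp k n hn ih Y g hg1 hg2 hg3 hY Γ b hb1 hb2 hb3 hbb hΓ ⟨I, hbl, hord, hcore, hloc⟩
  · exact hH p hp k n hn ih Y g hg1 hg2 hg3 hY Γ b hb1 hb2 hb3 hbb hΓ ⟨I, hbl, hord, ⟨hsome, fun y hyn hcf hhyp => hcore ⟨y, hyn, hcf, hhyp⟩⟩, hloc⟩

/-- the glued split is EXACT: `StepContactFree ⟺ StepCFHigher ∧ StepPICore`. -/
theorem stepContactFree_iff_cfHigher_and_core : MaxContactCut.StepContactFree ↔ StepCFHigher ∧ StepPICore :=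
  ⟨fun h => ⟨stepCFHigher_of_stepContactFree h, stepPICore_of_stepContactFree h⟩,
    fun h => stepContactFree_of_cfHigher_of_core h.1 h.2⟩

/-- the plain step implies its contact class (MaxContactCut kernel, restated here for the three-way partition). -/
theorem stepContact_of_step (h : MaxContactCut.Step) : MaxContactCut.StepContact := by
  intro p hp k _ _ n hn ih Y g hg1 hg2 hg3 hY Γ b hb1 hb2 hb3 hbb hΓ hdat
  obtain ⟨I, hbl, hord, -, hloc⟩ := hdat
  exact h p hp k n hn ih Y g hg1 hg2 hg3 hY Γ b hb1 hb2 hb3 hbb hΓ ⟨I, hbl, hord, hloc⟩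

/-- the plain step implies its contact-free class. -/
theorem stepContactFree_of_step (h : MaxContactCut.Step) : MaxContactCut.StepContactFree := by
  intro p hp k _ _ n hn ih Y g hg1 hg2 hg3 hY Γ b hb1 hb2 hb3 hbb hΓ hdat
  obtain ⟨I, hbl, hord, -, hloc⟩ := hdat
  exact h p hp k n hn ih Y g hg1 hg2 hg3 hY Γ b hb1 hb2 hb3 hbb hΓ ⟨I, hbl, hord, hloc⟩

/-- contact cut: the two classes give back the plain step (excluded middle on the existence of a contact-free top point). -/
theorem step_of_contact_of_free (hC : MaxContactCut.StepContact) (hF : MaxContactCut.StepContactFree) : MaxContactCut.Step := by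
  intro p hp k _ _ n hn ih Y g hg1 hg2 hg3 hY Γ b hb1 hb2 hb3 hbb hΓ hdat
  obtain ⟨I, hbl, hord, hloc⟩ := hdat
  by_cases hfree : ∃ y : Y, Literature.AlgebraicGeometry.Resolution.idealOrder I y = ((n : ℕ) : ℕ∞) ∧ ¬ (∃ U : Y.affineOpens, ∃ hy : y ∈ (U : Y.Opens), ∃ u ∈ (Literature.AlgebraicGeometry.Resolution.diffIdealSheaf (g.appTop.hom.comp (AlgebraicGeometry.Scheme.ΓSpecIso (.of k)).inv.hom) (n - 1) I).ideal U, (Y.presheaf.germ U y hy).hom u ∈ IsLocalRing.maximalIdeal (Y.presheaf.stalk y) ∧ (Y.presheaf.germ U y hy).hom u ∉ IsLocalRing.maximalIdeal (Y.presheaf.stalk y) ^ 2)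
  · exact hF p hp k n hn ih Y g hg1 hg2 hg3 hY Γ b hb1 hb2 hb3 hbb hΓ ⟨I, hbl, hord, hfree, hloc⟩
  · exact hC p hp k n hn ih Y g hg1 hg2 hg3 hY Γ b hb1 hb2 hb3 hbb hΓ ⟨I, hbl, hord, fun y hyn => Classical.by_contradiction fun hB => hfree ⟨y, hyn, hB⟩, hloc⟩

/-- EXACT THREE-WAY PARTITION of the order-reduction step: all top points have contact ∣ some contact-free top point and all such of
type ≥ 2 ∣ some purely inseparable hyperplanar top point. -/
theorem step_iff_three : MaxContactCut.Step ↔ MaxContactCut.StepContact ∧ StepCFHigher ∧ StepPICore :=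
  ⟨fun h => ⟨stepContact_of_step h, stepCFHigher_of_stepContactFree (stepContactFree_of_step h),
      stepPICore_of_stepContactFree (stepContactFree_of_step h)⟩,
    fun h => step_of_contact_of_free h.1 (stepContactFree_of_cfHigher_of_core h.2.1 h.2.2)⟩


/-! ## Kernels (dim-4 rungs) — pure logic: excluded middle on the pointwise datum, no blow-up absorption -/

/-- dim-4 rung, exactness, generic half. -/
theorem stepCFHigherDimFour_of_stepContactFreeDimFour (h : MaxContactCut.StepContactFreeDimFour) : StepCFHigherDimFour := by
  intro p hp k _ _ n hn ih Y g hg1 hg2 hg3 hY hY4 Γ b hb1 hb2 hb3 hbb hΓ hdat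
  obtain ⟨I, hbl, hord, ⟨hsome, -⟩, hloc⟩ := hdat
  exact h p hp k n hn ih Y g hg1 hg2 hg3 hY hY4 Γ b hb1 hb2 hb3 hbb hΓ ⟨I, hbl, hord, hsome, hloc⟩

/-- dim-4 rung, exactness, special half. -/
theorem stepPICoreDimFour_of_stepContactFreeDimFour (h : MaxContactCut.StepContactFreeDimFour) : StepPICoreDimFour := by
  intro p hp k _ _ n hn ih Y g hg1 hg2 hg3 hY hY4 Γ b hb1 hb2 hb3 hbb hΓ hdat
  obtain ⟨I, hbl, hord, ⟨y, hyn, hcf, -⟩, hloc⟩ := hdat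
  exact h p hp k n hn ih Y g hg1 hg2 hg3 hY hY4 Γ b hb1 hb2 hb3 hbb hΓ ⟨I, hbl, hord, ⟨y, hyn, hcf⟩, hloc⟩

/-- EXACT refinement of MaxContactCut's residual BY NAME: the contact-free step splits into the higher-type class and the core. -/
theorem stepContactFreeDimFour_of_cfHigher_of_core (hH : StepCFHigherDimFour) (hK : StepPICoreDimFour) : MaxContactCut.StepContactFreeDimFour := by
  intro p hp k _ _ n hn ih Y g hg1 hg2 hg3 hY hY4 Γ b hb1 hb2 hb3 hbb hΓ hdat
  obtain ⟨I, hbl, hord, hsome, hloc⟩ := hdat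
  by_cases hcore : ∃ y : Y, Literature.AlgebraicGeometry.Resolution.idealOrder I y = ((n : ℕ) : ℕ∞) ∧ ¬ (∃ U : Y.affineOpens, ∃ hy : y ∈ (U : Y.Opens), ∃ u ∈ (Literature.AlgebraicGeometry.Resolution.diffIdealSheaf (g.appTop.hom.comp (AlgebraicGeometry.Scheme.ΓSpecIso (.of k)).inv.hom) (n - 1) I).ideal U, (Y.presheaf.germ U y hy).hom u ∈ IsLocalRing.maximalIdeal (Y.presheaf.stalk y) ∧ (Y.presheaf.germ U y hy).hom u ∉ IsLocalRing.maximalIdeal (Y.presheaf.stalk y) ^ 2) ∧ (∃ U : Y.affineOpens, ∃ hy : y ∈ (U : Y.Opens), ∃ z : Y.presheaf.obj (Opposite.op (U : Y.Opens)), (Y.presheaf.germ U y hy).hom z ∈ IsLocalRing.maximalIdeal (Y.presheaf.stalk y) ∧ (Y.presheaf.germ U y hy).hom z ∉ IsLocalRing.maximalIdeal (Y.presheaf.stalk y) ^ 2 ∧ ∀ i : ℕ, i < n → ∀ u ∈ (Literature.AlgebraicGeometry.Resolution.diffIdealSheaf (g.appTop.hom.comp (AlgebraicGeometry.Scheme.ΓSpecIso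 (.of k)).inv.hom) i I).ideal U, (Y.presheaf.germ U y hy).hom u ∈ Ideal.span {(Y.presheaf.germ U y hy).hom z ^ (n - i)} ⊔ IsLocalRing.maximalIdeal (Y.presheaf.stalk y) ^ (n - i + 1))
  · exact hK p hp k n hn ih Y g hg1 hg2 hg3 hY hY4 Γ b hb1 hb2 hb3 hbb hΓ ⟨I, hbl, hord, hcore, hloc⟩
  · exact hH p hp k n hn ih Y g hg1 hg2 hg3 hY hY4 Γ b hb1 hb2 hb3 hbb hΓ ⟨I, hbl, hord, ⟨hsome, fun y hyn hcf hhyp => hcore ⟨y, hyn, hcf, hhyp⟩⟩, hloc⟩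

/-- dim-4 rung: `StepContactFreeDimFour (28010) ⟺ StepCFHigherDimFour (28543) ∧ StepPICoreDimFour (28544)`. -/
theorem stepContactFreeDimFour_iff_cfHigher_and_core : MaxContactCut.StepContactFreeDimFour ↔ StepCFHigherDimFour ∧ StepPICoreDimFour :=
  ⟨fun h => ⟨stepCFHigherDimFour_of_stepContactFreeDimFour h, stepPICoreDimFour_of_stepContactFreeDimFour h⟩,
    fun h => stepContactFreeDimFour_of_cfHigher_of_core h.1 h.2⟩

/-- dim-4 rung of `stepContact_of_step`. -/
theorem stepContactDimFour_of_stepDimFour (h : MaxContactCut.StepDimFour) : MaxContactCut.StepContactDimFour := by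
  intro p hp k _ _ n hn ih Y g hg1 hg2 hg3 hY hY4 Γ b hb1 hb2 hb3 hbb hΓ hdat
  obtain ⟨I, hbl, hord, -, hloc⟩ := hdat
  exact h p hp k n hn ih Y g hg1 hg2 hg3 hY hY4 Γ b hb1 hb2 hb3 hbb hΓ ⟨I, hbl, hord, hloc⟩

/-- dim-4 rung of `stepContactFree_of_step`. -/
theorem stepContactFreeDimFour_of_stepDimFour (h : MaxContactCut.StepDimFour) : MaxContactCut.StepContactFreeDimFour := by
  intro p hp k _ _ n hn ih Y g hg1 hg2 hg3 hY hY4 Γ b hb1 hb2 hb3 hbb hΓ hdat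
  obtain ⟨I, hbl, hord, -, hloc⟩ := hdat
  exact h p hp k n hn ih Y g hg1 hg2 hg3 hY hY4 Γ b hb1 hb2 hb3 hbb hΓ ⟨I, hbl, hord, hloc⟩

/-- dim-4 rung of `step_of_contact_of_free`. -/
theorem stepDimFour_of_contact_of_free (hC : MaxContactCut.StepContactDimFour) (hF : MaxContactCut.StepContactFreeDimFour) : MaxContactCut.StepDimFour := by
  intro p hp k _ _ n hn ih Y g hg1 hg2 hg3 hY hY4 Γ b hb1 hb2 hb3 hbb hΓ hdat
  obtain ⟨I, hbl, hord, hloc⟩ := hdat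
  by_cases hfree : ∃ y : Y, Literature.AlgebraicGeometry.Resolution.idealOrder I y = ((n : ℕ) : ℕ∞) ∧ ¬ (∃ U : Y.affineOpens, ∃ hy : y ∈ (U : Y.Opens), ∃ u ∈ (Literature.AlgebraicGeometry.Resolution.diffIdealSheaf (g.appTop.hom.comp (AlgebraicGeometry.Scheme.ΓSpecIso (.of k)).inv.hom) (n - 1) I).ideal U, (Y.presheaf.germ U y hy).hom u ∈ IsLocalRing.maximalIdeal (Y.presheaf.stalk y) ∧ (Y.presheaf.germ U y hy).hom u ∉ IsLocalRing.maximalIdeal (Y.presheaf.stalk y) ^ 2)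
  · exact hF p hp k n hn ih Y g hg1 hg2 hg3 hY hY4 Γ b hb1 hb2 hb3 hbb hΓ ⟨I, hbl, hord, hfree, hloc⟩
  · exact hC p hp k n hn ih Y g hg1 hg2 hg3 hY hY4 Γ b hb1 hb2 hb3 hbb hΓ ⟨I, hbl, hord, fun y hyn => Classical.by_contradiction fun hB => hfree ⟨y, hyn, hB⟩, hloc⟩

/-- EXACT THREE-WAY PARTITION of the order-reduction step: all top points have contact ∣ some contact-free top point and all such of
type ≥ 2 ∣ some purely inseparable hyperplanar top point. -/
theorem stepDimFour_iff_three : MaxContactCut.StepDimFour ↔ MaxContactCut.StepContactDimFour ∧ StepCFHigherDimFour ∧ StepPICoreDimFour :=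
  ⟨fun h => ⟨stepContactDimFour_of_stepDimFour h, stepCFHigherDimFour_of_stepContactFreeDimFour (stepContactFreeDimFour_of_stepDimFour h),
      stepPICoreDimFour_of_stepContactFreeDimFour (stepContactFreeDimFour_of_stepDimFour h)⟩,
    fun h => stepDimFour_of_contact_of_free h.1 (stepContactFreeDimFour_of_cfHigher_of_core h.2.1 h.2.2)⟩


/-! ## The dim-4 LOCATION THEOREM against OrderCut.PencilResolveDimFour (27135) BY NAME -/

/-- induction on the order bound at the dim-4 rung: the order-one base and the step give PR^{≤N}₄ for every N. -/
theorem prLEDimFour_of_base_of_step (h1 : MaxContactCut.LocalOrderOneResolveDimFour) (hS : MaxContactCut.StepDimFour) (p : ℕ) (hp : p.Prime)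
    (k : Type) [Field k] [CharP k p] (N : ℕ) : ∀ (Y : AlgebraicGeometry.Scheme.{0}) (g : Y ⟶ AlgebraicGeometry.Spec (.of k)), AlgebraicGeometry.IsSeparated g → AlgebraicGeometry.LocallyOfFiniteType g → AlgebraicGeometry.QuasiCompact g → Literature.AlgebraicGeometry.Resolution.Scheme.IsRegular Y → topologicalKrullDim Y ≤ 4 → ∀ (Γ : AlgebraicGeometry.Scheme.{0}) (b : Γ ⟶ Y), AlgebraicGeometry.IsSeparated b → AlgebraicGeometry.LocallyOfFiniteType b → AlgebraicGeometry.QuasiCompact b → Literature.AlgebraicGeometry.Resolution.IsBirational b → AlgebraicGeometry.IsReduced Γ → (∃ I : Y.IdealSheafData, Literature.AlgebraicGeometry.Resolution.IsBlowup b I ∧ (∀ y : Y, Literature.AlgebraicGeometry.Resolution.idealOrder I y ≤ ((N : ℕ) : ℕ∞)) ∧ ∀ y : Y, ∃ U : Y.affineOpens, y ∈ (U : Y.Opens) ∧ ∃ x h : Y.presheaf.obj (Opposite.op (U : Y.Opens)), I.ideal U = Ideal.span {x, h}) → Literature.AlgebraicGeometry.Resolution.Scheme.HasResolution Γ := by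
  induction N with
  | zero =>
    intro Y g hg1 hg2 hg3 hY hY4 Γ b hb1 hb2 hb3 hbb hΓ hdat
    obtain ⟨I, hbl, hord, hloc⟩ := hdat
    exact h1 p hp k Y g hg1 hg2 hg3 hY hY4 Γ b hb1 hb2 hb3 hbb hΓ
      ⟨I, hbl, fun y => ⟨(hord y).trans (by simp), hloc y⟩⟩
  | succ N ih =>
    intro Y g hg1 hg2 hg3 hY hY4 Γ b hb1 hb2 hb3 hbb hΓ hdat
    obtain ⟨I, hbl, hord, hloc⟩ := hdat
    rcases Nat.eq_zero_or_pos N with hN | hN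
    · subst hN
      exact h1 p hp k Y g hg1 hg2 hg3 hY hY4 Γ b hb1 hb2 hb3 hbb hΓ
        ⟨I, hbl, fun y => ⟨(hord y).trans (by simp), hloc y⟩⟩
    · exact hS p hp k (N + 1) (by omega) ih Y g hg1 hg2 hg3 hY hY4 Γ b hb1 hb2 hb3 hbb hΓ ⟨I, hbl, hord, hloc⟩

/-- the dim-4 pencil residual `OrderCut.PencilResolveDimFour` (27135) from the order bound, the order-one base and the three step classes. -/
theorem pencilResolveDimFour_of_pieces (hB : MaxContactCut.OrderBound) (h1 : MaxContactCut.LocalOrderOneResolveDimFour)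
    (hC : MaxContactCut.StepContactDimFour) (hH : StepCFHigherDimFour) (hK : StepPICoreDimFour) : OrderCut.PencilResolveDimFour := by
  intro p hp k _ _ Y g hg1 hg2 hg3 hY hY4 Γ b hb1 hb2 hb3 hbb hΓ hpen
  obtain ⟨I, hbl, hloc⟩ := hpen
  obtain ⟨N, hN⟩ := hB p hp k Y g hg1 hg2 hg3 hY Γ b hb1 hb2 hb3 hbb hΓ I hbl hloc
  exact prLEDimFour_of_base_of_step h1 (stepDimFour_iff_three.mpr ⟨hC, hH, hK⟩) p hp k N Y g hg1 hg2 hg3 hY hY4 Γ b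
    hb1 hb2 hb3 hbb hΓ ⟨I, hbl, hN, hloc⟩

/-- converse: PR₄ gives the dim-4 step (drop the order clause). -/
theorem stepDimFour_of_pencilResolveDimFour (h : OrderCut.PencilResolveDimFour) : MaxContactCut.StepDimFour := by
  intro p hp k _ _ n hn ih Y g hg1 hg2 hg3 hY hY4 Γ b hb1 hb2 hb3 hbb hΓ hdat
  obtain ⟨I, hbl, -, hloc⟩ := hdat
  exact h p hp k Y g hg1 hg2 hg3 hY hY4 Γ b hb1 hb2 hb3 hbb hΓ ⟨I, hbl, hloc⟩

/-- converse: PR₄ gives the dim-4 order-one base. -/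
theorem localOrderOneResolveDimFour_of_pencilResolveDimFour (h : OrderCut.PencilResolveDimFour) :
    MaxContactCut.LocalOrderOneResolveDimFour := by
  intro p hp k _ _ Y g hg1 hg2 hg3 hY hY4 Γ b hb1 hb2 hb3 hbb hΓ hdat
  obtain ⟨I, hbl, hI⟩ := hdat
  exact h p hp k Y g hg1 hg2 hg3 hY hY4 Γ b hb1 hb2 hb3 hbb hΓ ⟨I, hbl, fun y => (hI y).2⟩

/-- EQUIV at the dim-4 rung (conditional only on the COSTUME support OrderBound): the pencil residual PR₄ is the conjunction of the
order-one base and the three step classes. -/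
theorem pencilResolveDimFour_iff_pieces (hB : MaxContactCut.OrderBound) :
    OrderCut.PencilResolveDimFour ↔ MaxContactCut.LocalOrderOneResolveDimFour ∧ MaxContactCut.StepContactDimFour ∧
      StepCFHigherDimFour ∧ StepPICoreDimFour :=
  ⟨fun h => ⟨localOrderOneResolveDimFour_of_pencilResolveDimFour h,
      (stepDimFour_iff_three.mp (stepDimFour_of_pencilResolveDimFour h)).1,
      (stepDimFour_iff_three.mp (stepDimFour_of_pencilResolveDimFour h)).2.1,
      (stepDimFour_iff_three.mp (stepDimFour_of_pencilResolveDimFour h)).2.2⟩,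
    fun h => pencilResolveDimFour_of_pieces hB h.1 h.2.1 h.2.2.1 h.2.2.2⟩

/-- **LOCATION THEOREM (gen 5)**: modulo the pocket pieces — order bound, order-one base, the contact class AND the higher-type class —
the dim-4 pencil residual `OrderCut.PencilResolveDimFour` (27135) IS EXACTLY the purely-inseparable-hyperplanar step. -/
theorem pencilResolveDimFour_iff_core_of_pocket (hB : MaxContactCut.OrderBound) (h1 : MaxContactCut.LocalOrderOneResolveDimFour)
    (hC : MaxContactCut.StepContactDimFour) (hH : StepCFHigherDimFour) : OrderCut.PencilResolveDimFour ↔ StepPICoreDimFour :=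
  ⟨fun h => (stepDimFour_iff_three.mp (stepDimFour_of_pencilResolveDimFour h)).2.2,
    fun hK => pencilResolveDimFour_of_pieces hB h1 hC hH hK⟩

/-! ## Necessity of every piece from the ROOT (no piece is stronger than the summit) -/


/-- the ROOT resolves every reduced Γ separated of finite type over a field of char p (through `Γ → Y → Spec k`). -/
theorem hasResolution_of_summit (h : _root_.ResolutionOfSingularities) {p : ℕ} (hp : p.Prime) (k : Type) [Field k]
    [CharP k p] {Y : Scheme.{0}} (g : Y ⟶ Spec (.of k)) (hg1 : IsSeparated g) (hg2 : LocallyOfFiniteType g)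
    (hg3 : QuasiCompact g) {Γ : Scheme.{0}} (b : Γ ⟶ Y) (hb1 : IsSeparated b) (hb2 : LocallyOfFiniteType b)
    (hb3 : QuasiCompact b) (hΓ : IsReduced Γ) : Scheme.HasResolution Γ := by
  haveI := hg1; haveI := hg2; haveI := hg3; haveI := hb1; haveI := hb2; haveI := hb3; haveI := hΓ
  exact _root_.ResolutionOfSingularities_iff.mp h p hp k Γ (b ≫ g) inferInstance inferInstance
    inferInstance inferInstance

/-- necessity: the plain step follows from the ROOT. -/
theorem step_of_summit (h : _root_.ResolutionOfSingularities) : MaxContactCut.Step :=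
  fun _p hp k _ _ _n _hn _ih _Y g hg1 hg2 hg3 _hY _Γ b hb1 hb2 hb3 _hbb hΓ _ =>
    hasResolution_of_summit h hp k g hg1 hg2 hg3 b hb1 hb2 hb3 hΓ

/-- necessity: the dim-4 step follows from the ROOT. -/
theorem stepDimFour_of_summit (h : _root_.ResolutionOfSingularities) : MaxContactCut.StepDimFour :=
  fun _p hp k _ _ _n _hn _ih _Y g hg1 hg2 hg3 _hY _hY4 _Γ b hb1 hb2 hb3 _hbb hΓ _ =>
    hasResolution_of_summit h hp k g hg1 hg2 hg3 b hb1 hb2 hb3 hΓ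

/-- necessity of StepContact (28005). -/
theorem stepContact_of_summit (h : _root_.ResolutionOfSingularities) : MaxContactCut.StepContact :=
  stepContact_of_step (step_of_summit h)

/-- necessity of StepCFHigher (28537). -/
theorem stepCFHigher_of_summit (h : _root_.ResolutionOfSingularities) : StepCFHigher :=
  stepCFHigher_of_stepContactFree (stepContactFree_of_step (step_of_summit h))

/-- necessity of StepPICore (28538). -/
theorem stepPICore_of_summit (h : _root_.ResolutionOfSingularities) : StepPICore :=
  stepPICore_of_stepContactFree (stepContactFree_of_step (step_of_summit h))


/-- necessity of StepContactDimFour (28009). -/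
theorem stepContactDimFour_of_summit (h : _root_.ResolutionOfSingularities) : MaxContactCut.StepContactDimFour :=
  stepContactDimFour_of_stepDimFour (stepDimFour_of_summit h)

/-- necessity of StepCFHigherDimFour (28543). -/
theorem stepCFHigherDimFour_of_summit (h : _root_.ResolutionOfSingularities) : StepCFHigherDimFour :=
  stepCFHigherDimFour_of_stepContactFreeDimFour (stepContactFreeDimFour_of_stepDimFour (stepDimFour_of_summit h))

/-- necessity of StepPICoreDimFour (28544). -/
theorem stepPICoreDimFour_of_summit (h : _root_.ResolutionOfSingularities) : StepPICoreDimFour :=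
  stepPICoreDimFour_of_stepContactFreeDimFour (stepContactFreeDimFour_of_stepDimFour (stepDimFour_of_summit h))


/-! ## Deciding theorem: the node's pieces reach the ROOT through MaxContactCut.closes BY NAME -/

/-- `closes`: RegularRoofs (24573) → PencilReduction (27129) → OrderBound (28006) → LocalOrderOneResolve (27132) → StepContact (28005) →
StepCFHigher (NEW) → StepPICore (NEW residual) → the ROOT. Pure logic: the exact kernel `stepContactFree_of_cfHigher_of_core` feeds
`MaxContactCut.closes`. -/
theorem closes_tauCut (hR : MaxContactCut.RegularRoofs) (hP : MaxContactCut.PencilReduction) (hB : MaxContactCut.OrderBound)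
    (h1 : MaxContactCut.LocalOrderOneResolve) (hC : MaxContactCut.StepContact) (hH : StepCFHigher) (hK : StepPICore) :
    _root_.ResolutionOfSingularities :=
  MaxContactCut.closes hR hP hB h1 hC (stepContactFree_of_cfHigher_of_core hH hK)

/-- **GLUE ITEM stmt-28539 proved**: `StepContactFreeOfTauCut = (StepCFHigher → StepPICore → StepContactFree)`. -/
theorem stepContactFreeOfTauCut_holds : StepContactFreeOfTauCut :=
  fun hH hK => stepContactFree_of_cfHigher_of_core hH hK

/-- the whole node is necessary: every new hypothesis of `closes_tauCut` follows from the ROOT. -/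
theorem pieces_of_summit (h : _root_.ResolutionOfSingularities) :
    MaxContactCut.StepContact ∧ StepCFHigher ∧ StepPICore ∧ StepCFHigherDimFour ∧ StepPICoreDimFour :=
  ⟨stepContact_of_summit h, stepCFHigher_of_summit h, stepPICore_of_summit h, stepCFHigherDimFour_of_summit h,
    stepPICoreDimFour_of_summit h⟩

end Summit.ResolutionOfSingularities.ResolutionOfSingularities.Theorems.MaxContactCutTauCut
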